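import Summits.KontsevichZagierPeriods.KontsevichZagierPeriods.Theorems.StuffleInKZ.Negative.ChangeOfVariablesFree

/-!
# `StuffleInKZ` (stmt-3931), negative side, cycle 3 — rule (1b) is DERIVABLE from rules (1a) + (3):
# part 1, the gluing toolkit (piecewise semialgebraic functions, the segments, the `C¹` primitives)

Structure theorem for the Kontsevich–Zagier calculus of `KZCalculus.lean`, completing the
independence analysis of the cdisprove unit (`NewtonLeibnizFree.lean`: (3) is independent of
(1)+(2); `ChangeOfVariablesFree.lean`: (2) is independent of (1)+(3)): **integrand additivity is
redundant** —

  `integrandAddRel ⊆ closure (domainAddRel ∪ newtonLeibnizRel)`   (`integrandAddRel_subset_closure_domAdd_nl`),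

hence `relations = closure (domainAddRel ∪ changeOfVariablesRel ∪ newtonLeibnizRel)`
(`relations_eq_closure_three_rules`) and `covFreeRelations = closure (domainAddRel ∪ newtonLeibnizRel)`.

Construction (one dimension up). Given `f = f₁ + f₂` on `σ`, put over `σ` the band `σ × [0,1]`
with the CONTINUOUS integrand `g(x,t) = 8(½ − t) f₁(x)` (`t ≤ ½`), `8(t − ½) f₂(x)` (`t ≥ ½`), which
vanishes on the interface `t = ½`. Newton–Leibniz along `t` with the `C¹` piecewise-polynomial
primitive `F = f₁ Ψ₁ + f₂ Ψ₂` (`Ψ₁ = 4t − 4t²`, then `1`; `Ψ₂ = 0`, then `4(t − ½)²`) gives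
`[band, g] ~ [σ, f₁ + f₂]`; domain additivity cuts the band at `t = ½` (null interface); and
Newton–Leibniz on each half gives `[σ, f₁]`, `[σ, f₂]` (the halves are the PRODUCTS
`r₁ × [[0,½], 8(½−t)]`, `r₂ × [[½,1], 8(t−½)]`, so their semialgebraicity and integrability come
from `KZ.IntegralRep.prod`). For the stuffle: the minimal rule sets are `{(1b), (2)}` (the cubical
chain) or `{(1a), (2), (3)}`; some additivity and some change of variables are unavoidable
(`LoadBearing.lean`, `ChangeOfVariablesNecessary.lean`). [folklore]
-/

noncomputable section

namespace Summit.KontsevichZagierPeriods.Theorems.StuffleInKZ.Negative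

namespace Derived

open MeasureTheory Set Filter
open scoped Topology
open Literature.NumberTheory.Transcendental
open Literature.NumberTheory.Transcendental.KZ
open Literature.ModelTheory.ExponentialFields (IsSemialgebraic isSemialgebraic_univ
  isSemialgebraic_setOf_eval_pos isSemialgebraic_setOf_eval_eq_zero isSemialgebraic_setOf_eval_le)
open MvPolynomial (aeval X C)

variable {n : ℕ}

/-! ### Semialgebraic toolkit: piecewise functions, functions of the last coordinate -/

open Classical in
/-- **Piecewise semialgebraic functions are semialgebraic** (the graph is the union of the two
restricted graphs; no Tarski–Seidenberg). [folklore] -/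
theorem isSemialgebraicFunOn_piecewise {m : ℕ} {s A : Set (Fin m → ℝ)} {f g : (Fin m → ℝ) → ℝ}
    (hf : IsSemialgebraicFunOn ℚ (s ∩ A) f) (hg : IsSemialgebraicFunOn ℚ (s \ A) g) :
    IsSemialgebraicFunOn ℚ s (A.piecewise f g) := by
  rw [isSemialgebraicFunOn_iff] at hf hg ⊢
  convert hf.union hg using 1
  ext z
  simp only [mem_setOf_eq, mem_union, mem_inter_iff, Set.mem_sdiff]
  by_cases hz : Fin.init z ∈ A
  · rw [piecewise_eq_of_mem _ _ _ hz]
    constructor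
    · rintro ⟨hs, hy⟩; exact Or.inl ⟨⟨hs, hz⟩, hy⟩
    · rintro (⟨⟨hs, -⟩, hy⟩ | ⟨⟨-, hnz⟩, -⟩)
      · exact ⟨hs, hy⟩
      · exact absurd hz hnz
  · rw [piecewise_eq_of_notMem _ _ _ hz]
    constructor
    · rintro ⟨hs, hy⟩; exact Or.inr ⟨⟨hs, hz⟩, hy⟩
    · rintro (⟨⟨-, hA⟩, -⟩ | ⟨⟨hs, -⟩, hy⟩)
      · exact absurd hA hz
      · exact ⟨hs, hy⟩

/-- A polynomial in the last coordinate, `z ↦ p(z_last)`, as `aeval` of a polynomial over `ℚ`. -/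
theorem isSemialgebraicFunOn_poly_last {m : ℕ} {s : Set (Fin (m + 1) → ℝ)} (hs : IsSemialgebraic ℚ s)
    (p : MvPolynomial (Fin (m + 1)) ℚ) : IsSemialgebraicFunOn ℚ s (fun z => aeval z p) :=
  isSemialgebraicFunOn_aeval hs p

/-- The half-space `{z | z_last ≤ ½}` is `ℚ`-semialgebraic. [folklore] -/
theorem isSemialgebraic_last_le_half (m : ℕ) :
    IsSemialgebraic ℚ {z : Fin (m + 1) → ℝ | z (Fin.last m) ≤ 1 / 2} := by
  have e : {z : Fin (m + 1) → ℝ | z (Fin.last m) ≤ 1 / 2} =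
      {z | aeval z (X (Fin.last m) : MvPolynomial (Fin (m + 1)) ℚ) ≤
        aeval z (C (1 / 2 : ℚ) : MvPolynomial (Fin (m + 1)) ℚ)} := by
    ext z
    simp
  rw [e]
  exact isSemialgebraic_setOf_eval_le _ _

/-! ### The two segments and the gluing polynomials -/

/-- The segment `{a ≤ w₀ ≤ b} ⊆ ℝ¹` is `ℚ`-semialgebraic. [folklore] -/
theorem isSemialgebraic_seg (a b : ℚ) :
    IsSemialgebraic ℚ {w : Fin 1 → ℝ | (a : ℝ) ≤ w 0 ∧ w 0 ≤ (b : ℝ)} := by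
  have e : {w : Fin 1 → ℝ | (a : ℝ) ≤ w 0 ∧ w 0 ≤ (b : ℝ)} =
      {w | aeval w (C a : MvPolynomial (Fin 1) ℚ) ≤ aeval w (X 0 : MvPolynomial (Fin 1) ℚ)} ∩
        {w | aeval w (X 0 : MvPolynomial (Fin 1) ℚ) ≤ aeval w (C b : MvPolynomial (Fin 1) ℚ)} := by
    ext w
    simp
  rw [e]
  exact (isSemialgebraic_setOf_eval_le _ _).inter (isSemialgebraic_setOf_eval_le _ _)

/-- The segment `{w | a ≤ w₀ ≤ b} ⊆ ℝ¹` with the affine integrand `c · (w₀ − d)`. -/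
def segRep' (a b c d : ℚ) : IntegralRep 1 where
  domain := {w | (a : ℝ) ≤ w 0 ∧ w 0 ≤ (b : ℝ)}
  integrand := fun w => (c : ℝ) * (w 0 - d)
  isSemialgebraic_domain := isSemialgebraic_seg a b
  isSemialgebraicFunOn_integrand := by
    refine (isSemialgebraicFunOn_aeval (isSemialgebraic_seg a b)
      (C c * (X 0 - C d) : MvPolynomial (Fin 1) ℚ)).congr ?_
    intro w _
    simp
  integrableOn := by
    have hK : IsCompact {w : Fin 1 → ℝ | (a : ℝ) ≤ w 0 ∧ w 0 ≤ (b : ℝ)} := by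
      refine Metric.isCompact_of_isClosed_isBounded ?_ ?_
      · exact (isClosed_le continuous_const (continuous_apply 0)).inter
          (isClosed_le (continuous_apply 0) continuous_const)
      · refine (Metric.isBounded_closedBall (x := (0 : Fin 1 → ℝ))
          (r := |(a : ℝ)| + |(b : ℝ)|)).subset ?_
        intro w hw
        rw [mem_closedBall_zero_iff, pi_norm_le_iff_of_nonneg (by positivity)]
        intro i
        have hi : i = 0 := Subsingleton.elim i 0
        subst hi
        rw [Real.norm_eq_abs, abs_le]
        constructor <;> cases abs_cases (a : ℝ) <;> cases abs_cases (b : ℝ) <;> linarith [hw.1, hw.2]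
    exact ((continuous_const.mul ((continuous_apply 0).sub continuous_const)).continuousOn
      ).integrableOn_compact hK

/-- Domain of `segRep'`. [folklore] -/
@[simp] theorem segRep'_domain (a b c d : ℚ) :
    (segRep' a b c d).domain = {w | (a : ℝ) ≤ w 0 ∧ w 0 ≤ (b : ℝ)} := rfl

/-- Integrand of `segRep'`. [folklore] -/
@[simp] theorem segRep'_integrand (a b c d : ℚ) (w : Fin 1 → ℝ) :
    (segRep' a b c d).integrand w = (c : ℝ) * (w 0 - d) := rfl

/-- Lower segment `[[0,½], 8(½ − t)]` (integrand written as `(−8)(t − ½)`). -/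
def segLo : IntegralRep 1 := segRep' 0 (1 / 2) (-8) (1 / 2)

/-- Upper segment `[[½,1], 8(t − ½)]`. -/
def segHi : IntegralRep 1 := segRep' (1 / 2) 1 8 (1 / 2)

/-- The glued primitive pieces: `Ψ₁ = 4t − 4t²` then `1`; `Ψ₂ = 0` then `4(t − ½)²`. -/
def Ψ₁ (t : ℝ) : ℝ := if t ≤ 1 / 2 then 4 * t - 4 * t ^ 2 else 1
/-- See `Ψ₁`. -/
def Ψ₂ (t : ℝ) : ℝ := if t ≤ 1 / 2 then 0 else 4 * (t - 1 / 2) ^ 2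
/-- The glued integrand pieces: `ψ₁ = 8(½ − t)` then `0`; `ψ₂ = 0` then `8(t − ½)`. -/
def ψ₁ (t : ℝ) : ℝ := if t ≤ 1 / 2 then -8 * (t - 1 / 2) else 0
/-- See `ψ₁`. -/
def ψ₂ (t : ℝ) : ℝ := if t ≤ 1 / 2 then 0 else 8 * (t - 1 / 2)

/-- `Ψ₁` below `½`. -/ theorem Ψ₁_le {t : ℝ} (h : t ≤ 1 / 2) : Ψ₁ t = 4 * t - 4 * t ^ 2 := if_pos h
/-- `Ψ₁` above `½`. -/ theorem Ψ₁_gt {t : ℝ} (h : 1 / 2 < t) : Ψ₁ t = 1 := if_neg (not_le.mpr h)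
/-- `Ψ₂` below `½`. -/ theorem Ψ₂_le {t : ℝ} (h : t ≤ 1 / 2) : Ψ₂ t = 0 := if_pos h
/-- `Ψ₂` above `½`. -/ theorem Ψ₂_gt {t : ℝ} (h : 1 / 2 < t) : Ψ₂ t = 4 * (t - 1 / 2) ^ 2 := if_neg (not_le.mpr h)
/-- `ψ₁` below `½`. -/ theorem ψ₁_le {t : ℝ} (h : t ≤ 1 / 2) : ψ₁ t = -8 * (t - 1 / 2) := if_pos h
/-- `ψ₁` above `½`. -/ theorem ψ₁_gt {t : ℝ} (h : 1 / 2 < t) : ψ₁ t = 0 := if_neg (not_le.mpr h)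
/-- `ψ₂` below `½`. -/ theorem ψ₂_le {t : ℝ} (h : t ≤ 1 / 2) : ψ₂ t = 0 := if_pos h
/-- `ψ₂` above `½`. -/ theorem ψ₂_gt {t : ℝ} (h : 1 / 2 < t) : ψ₂ t = 8 * (t - 1 / 2) := if_neg (not_le.mpr h)

/-- Derivative of the lower polynomial `4t − 4t²`. [folklore] -/
theorem hasDerivAt_pLo (t : ℝ) : HasDerivAt (fun s : ℝ => 4 * s - 4 * s ^ 2) (-8 * (t - 1 / 2)) t := by
  have h1 : HasDerivAt (fun s : ℝ => 4 * s) 4 t := by simpa using (hasDerivAt_id t).const_mul (4 : ℝ)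
  have h2 : HasDerivAt (fun s : ℝ => 4 * s ^ 2) (4 * (2 * t)) t := by
    simpa using (hasDerivAt_pow 2 t).const_mul (4 : ℝ)
  exact (h1.sub h2).congr_deriv (by ring)

/-- Derivative of the upper polynomial `4(t − ½)²`. [folklore] -/
theorem hasDerivAt_pHi (t : ℝ) : HasDerivAt (fun s : ℝ => 4 * (s - 1 / 2) ^ 2) (8 * (t - 1 / 2)) t := by
  have h0 : HasDerivAt (fun s : ℝ => s - 1 / 2) 1 t := (hasDerivAt_id t).sub_const (1 / 2 : ℝ)
  have h : HasDerivAt (fun s : ℝ => (s - 1 / 2) ^ 2) ((2 : ℕ) * (t - 1 / 2) ^ (2 - 1) * 1) t :=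
    h0.pow 2
  exact (h.const_mul 4).congr_deriv (by norm_num; ring)

/-- **Gluing at `½`**: `Ψ₁' = ψ₁` everywhere (the one-sided derivatives at `½` both vanish). -/
theorem hasDerivAt_Ψ₁ (t : ℝ) : HasDerivAt Ψ₁ (ψ₁ t) t := by
  rcases lt_trichotomy t (1 / 2) with hlt | heq | hgt
  · have hev : (fun s : ℝ => 4 * s - 4 * s ^ 2) =ᶠ[𝓝 t] Ψ₁ := by
      filter_upwards [Iio_mem_nhds hlt] with s hs
      exact (Ψ₁_le (le_of_lt hs)).symm
    rw [ψ₁_le hlt.le]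
    exact (hasDerivAt_pLo t).congr_of_eventuallyEq hev.symm
  · subst heq
    rw [ψ₁_le le_rfl]
    have hl : HasDerivWithinAt Ψ₁ (-8 * ((1 : ℝ) / 2 - 1 / 2)) (Iic (1 / 2)) (1 / 2) :=
      (hasDerivAt_pLo _).hasDerivWithinAt.congr (fun s hs => Ψ₁_le hs) (Ψ₁_le le_rfl)
    have hr : HasDerivWithinAt Ψ₁ (-8 * ((1 : ℝ) / 2 - 1 / 2)) (Ici (1 / 2)) (1 / 2) := by
      have h0 : HasDerivWithinAt (fun _ : ℝ => (1 : ℝ)) (-8 * ((1 : ℝ) / 2 - 1 / 2)) (Ici (1 / 2)) (1 / 2) :=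
        ((hasDerivAt_const _ _).hasDerivWithinAt).congr_deriv (by ring)
      refine h0.congr (fun s hs => ?_) (by rw [Ψ₁_le le_rfl]; norm_num)
      rcases eq_or_lt_of_le (mem_Ici.mp hs) with h | h
      · rw [← h, Ψ₁_le le_rfl]; norm_num
      · exact Ψ₁_gt h
    have := hl.union hr
    rwa [Iic_union_Ici, hasDerivWithinAt_univ] at this
  · have hev : (fun _ : ℝ => (1 : ℝ)) =ᶠ[𝓝 t] Ψ₁ := by
      filter_upwards [Ioi_mem_nhds hgt] with s hs
      exact (Ψ₁_gt hs).symm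
    rw [ψ₁_gt hgt]
    exact (hasDerivAt_const t 1).congr_of_eventuallyEq hev.symm

/-- `Ψ₂' = ψ₂` everywhere. [folklore] -/
theorem hasDerivAt_Ψ₂ (t : ℝ) : HasDerivAt Ψ₂ (ψ₂ t) t := by
  rcases lt_trichotomy t (1 / 2) with hlt | heq | hgt
  · have hev : (fun _ : ℝ => (0 : ℝ)) =ᶠ[𝓝 t] Ψ₂ := by
      filter_upwards [Iio_mem_nhds hlt] with s hs
      exact (Ψ₂_le (le_of_lt hs)).symm
    rw [ψ₂_le hlt.le]
    exact (hasDerivAt_const t 0).congr_of_eventuallyEq hev.symm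
  · subst heq
    rw [ψ₂_le le_rfl]
    have hl : HasDerivWithinAt Ψ₂ 0 (Iic (1 / 2)) (1 / 2) :=
      ((hasDerivAt_const _ (0 : ℝ)).hasDerivWithinAt).congr (fun s hs => Ψ₂_le hs) (Ψ₂_le le_rfl)
    have hr : HasDerivWithinAt Ψ₂ 0 (Ici (1 / 2)) (1 / 2) := by
      have h0 : HasDerivWithinAt (fun s : ℝ => 4 * (s - 1 / 2) ^ 2) 0 (Ici (1 / 2)) (1 / 2) :=
        ((hasDerivAt_pHi _).hasDerivWithinAt).congr_deriv (by ring)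
      refine h0.congr (fun s hs => ?_) (by rw [Ψ₂_le le_rfl]; norm_num)
      rcases eq_or_lt_of_le (mem_Ici.mp hs) with h | h
      · rw [← h, Ψ₂_le le_rfl]; norm_num
      · exact Ψ₂_gt h
    have := hl.union hr
    rwa [Iic_union_Ici, hasDerivWithinAt_univ] at this
  · have hev : (fun s : ℝ => 4 * (s - 1 / 2) ^ 2) =ᶠ[𝓝 t] Ψ₂ := by
      filter_upwards [Ioi_mem_nhds hgt] with s hs
      exact (Ψ₂_gt hs).symm
    rw [ψ₂_gt hgt]
    exact (hasDerivAt_pHi t).congr_of_eventuallyEq hev.symm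

/-- `Ψ₁` is continuous. [folklore] -/
theorem continuous_Ψ₁ : Continuous Ψ₁ := continuous_iff_continuousAt.mpr fun t => (hasDerivAt_Ψ₁ t).continuousAt

/-- `Ψ₂` is continuous. [folklore] -/
theorem continuous_Ψ₂ : Continuous Ψ₂ := continuous_iff_continuousAt.mpr fun t => (hasDerivAt_Ψ₂ t).continuousAt

/-- `Ψ₁ ∘ last` is the piecewise of two polynomial maps. [folklore] -/
theorem Ψ₁_last_eq (m : ℕ) : (fun z : Fin (m + 1) → ℝ => Ψ₁ (z (Fin.last m))) =
    {z : Fin (m + 1) → ℝ | z (Fin.last m) ≤ 1 / 2}.piecewise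
      (fun z => aeval z (C (4 : ℚ) * X (Fin.last m) - C (4 : ℚ) * X (Fin.last m) ^ 2 :
        MvPolynomial (Fin (m + 1)) ℚ))
      (fun z => aeval z (1 : MvPolynomial (Fin (m + 1)) ℚ)) := by
  classical
  funext z
  by_cases hz : z (Fin.last m) ≤ 1 / 2
  · rw [piecewise_eq_of_mem _ _ _ (by exact hz), Ψ₁_le hz]
    simp
  · rw [piecewise_eq_of_notMem _ _ _ (by exact hz), Ψ₁_gt (not_le.mp hz)]
    simp

/-- `Ψ₂ ∘ last` is the piecewise of two polynomial maps. [folklore] -/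
theorem Ψ₂_last_eq (m : ℕ) : (fun z : Fin (m + 1) → ℝ => Ψ₂ (z (Fin.last m))) =
    {z : Fin (m + 1) → ℝ | z (Fin.last m) ≤ 1 / 2}.piecewise
      (fun z => aeval z (0 : MvPolynomial (Fin (m + 1)) ℚ))
      (fun z => aeval z (C (4 : ℚ) * (X (Fin.last m) - C (1 / 2 : ℚ)) ^ 2 :
        MvPolynomial (Fin (m + 1)) ℚ)) := by
  classical
  funext z
  by_cases hz : z (Fin.last m) ≤ 1 / 2
  · rw [piecewise_eq_of_mem _ _ _ (by exact hz), Ψ₂_le hz]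
    simp
  · rw [piecewise_eq_of_notMem _ _ _ (by exact hz), Ψ₂_gt (not_le.mp hz)]
    simp

/-- `Ψ₁ ∘ last` is semialgebraic on any semialgebraic set. [folklore] -/
theorem isSemialgebraicFunOn_Ψ₁_last {m : ℕ} {s : Set (Fin (m + 1) → ℝ)} (hs : IsSemialgebraic ℚ s) :
    IsSemialgebraicFunOn ℚ s (fun z => Ψ₁ (z (Fin.last m))) := by
  rw [Ψ₁_last_eq]
  have hA := isSemialgebraic_last_le_half m
  exact isSemialgebraicFunOn_piecewise (isSemialgebraicFunOn_aeval (hs.inter hA) _)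
    (isSemialgebraicFunOn_aeval (hs.diff hA) _)

/-- `Ψ₂ ∘ last` is semialgebraic on any semialgebraic set. [folklore] -/
theorem isSemialgebraicFunOn_Ψ₂_last {m : ℕ} {s : Set (Fin (m + 1) → ℝ)} (hs : IsSemialgebraic ℚ s) :
    IsSemialgebraicFunOn ℚ s (fun z => Ψ₂ (z (Fin.last m))) := by
  rw [Ψ₂_last_eq]
  have hA := isSemialgebraic_last_le_half m
  exact isSemialgebraicFunOn_piecewise (isSemialgebraicFunOn_aeval (hs.inter hA) _)
    (isSemialgebraicFunOn_aeval (hs.diff hA) _)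

end Derived

end Summit.KontsevichZagierPeriods.Theorems.StuffleInKZ.Negative
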